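import Literature.MathematicalPhysics.QuantumLattice.SectorisedEffectiveActionBoundPlateau
import Literature.MathematicalPhysics.QuantumLattice.SectorisedEffectiveActionBoundWeightedPlateau
import HarnessLib

/-!
# Re-sectorisation across a plateau pair: the sectorised `L¹–L^∞` norm of a polynomial in a FINER family from its norm in a
# COARSER one, at the cost of the overlap constants of the pair

Topic `MathematicalPhysics/QuantumLattice`; companion of `SectorisedEffectiveActionBoundPlateau`.  Benfatto–Giuliani–Mastropietro 2006,
(2.71a)/(2.82): rewriting the kernels sectorised at scale `h` in the sectors of scale `h − 1` costs, per external leg, the `L¹` norm of the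
overlap of the two multiplier families (the sector-lemma constants).  Here, with NO integration: for a thin/fat pair `F, F̃` (`F̃F = F`,
`Σ_ω F_ω(k) = 0 ⇒ F_ω(k) = 0`) and a second family `F′` supported inside the plateau `{Σ_ω F_ω = 1}` of `F`, and the overlap constants
`Σ_{X′} ‖(E(F′)·S(F̃))(X″, X′)‖ ≤ cr`, `Σ_{X″} ‖(E(F′)·S(F̃))(X″, X′)‖ ≤ cc`:

* `map_sectorAnalysis_eq_map_comp_sectorPreimage_of_plateau` — `map (toLin' E(F′)) G = map (toLin' (E(F′)·S(F̃))) (sectorPreimage β F G)`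
  (exact: the push-forward of the preimage is `S_R G`, and `E(F′)` does not see `S_R`);
* **`hubbardSectorKernelNorm_le_of_plateau_pair`** — in every degree `m + 1` and for every constraint set `A`,
  `hubbardSectorKernelNorm β F′ A G ≤ cr · cc^m · ε_x^m · (ε_x · hubbardSectorKernelNorm β F univ G)`.

In the KL programme this is the step «private invariant (family `n`) ⇒ public (E1-v4) quantity (family `n+1`)» of the norms induction
(k3c2-p3's SECTOR-RADIAL-ALIGNMENT §3: the thin family of index `n+1` lives inside the plateau of the thin family of index `n`, and the
overlap pair `(klAnisoFamily (n+1), bgmFatMultiplier n)` is the one the sector-lemma suppliers bound).  Everything is proved; no definitions;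
no named facts.

## Sources

G. Benfatto, A. Giuliani, V. Mastropietro, Ann. Henri Poincaré 7 (2006) 809–898 = arXiv:cond-mat/0507686, §2.7 (2.70)–(2.71a), §2.8 (2.82)
[`BenfattoGiulianiMastropietro2006`].
-/

noncomputable section

namespace Literature.MathematicalPhysics.QuantumLattice

open GrassmannAlgebra Finset Literature.Probability.LatticeModels

variable {L M : ℕ} [NeZero L] [NeZero M] {N N' : ℕ}

/-- **The analysis map of a family inside the plateau factors through the sector preimage**: if `F̃F = F`, `Σ_ω F_ω(k) = 0 ⇒ F_ω(k) = 0`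
and `Σ_ω F_ω = 1` on the support of `F′`, then `map (toLin' E(F′)) G = map (toLin' (E(F′)·S(F̃))) (sectorPreimage β F G)` for every `G`.
[cite: BenfattoGiulianiMastropietro2006, §2.7 (2.70)–(2.71a)] -/
theorem map_sectorAnalysis_eq_map_comp_sectorPreimage_of_plateau {β : ℝ} (hβ : β ≠ 0) (F Ft : Fin N → FreqMomentum L M → ℂ)
    (hFF : ∀ ω k, Ft ω k * F ω k = F ω k) (hF0 : ∀ k, ∑ ω, F ω k = 0 → ∀ ω, F ω k = 0) (F' : Fin N' → FreqMomentum L M → ℂ)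
    (hF'pl : ∀ (ω' : Fin N') (k : FreqMomentum L M), F' ω' k ≠ 0 → ∑ ω, F ω k = 1) (G : HubbardGrassmann L M) :
    ExteriorAlgebra.map (Matrix.toLin' (sectorAnalysisMatrix L M β F')) G =
      ExteriorAlgebra.map (Matrix.toLin' (sectorAnalysisMatrix L M β F') ∘ₗ Matrix.toLin' (sectorSubMatrix L M β Ft))
        (sectorPreimage β F G) := by
  set Rf : HubbardFieldIdx L M → ℂ := fun K => ∑ ω, F ω K.1.1 with hRf
  have hcomp : Matrix.toLin' (sectorAnalysisMatrix L M β F') ∘ₗ LinearMap.mulLeft ℂ Rf =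
      Matrix.toLin' (sectorAnalysisMatrix L M β F') :=
    toLin'_sectorAnalysis_comp_mulLeft β F' Rf fun ω' K hK => hF'pl ω' K.1.1 hK
  rw [← map_map_eq_map_comp, map_sectorSub_sectorPreimage_eq_map_mulLeft hβ F Ft hFF hF0 G, map_map_eq_map_comp, hcomp]

/-- **Re-sectorisation across a plateau pair** (BGM 2006, (2.71a)/(2.82): one overlap `L¹` norm per external leg, no integration): for a
thin/fat pair `F, F̃` and a family `F′` supported in the plateau of `F`, with overlap constants `(cr, cc)` of `E(F′)·S(F̃)`, in every degree
`m + 1` and for every constraint set `A`,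
`hubbardSectorKernelNorm β F′ A G ≤ cr · cc^m · ε_x^m · (ε_x · hubbardSectorKernelNorm β F univ G)`.
[cite: BenfattoGiulianiMastropietro2006, §2.8 (2.82)] -/
theorem hubbardSectorKernelNorm_le_of_plateau_pair {β : ℝ} (hβ : 0 < β) (F Ft : Fin N → FreqMomentum L M → ℂ)
    (hFF : ∀ ω k, Ft ω k * F ω k = F ω k) (hF0 : ∀ k, ∑ ω, F ω k = 0 → ∀ ω, F ω k = 0) (F' : Fin N' → FreqMomentum L M → ℂ)
    (hF'pl : ∀ (ω' : Fin N') (k : FreqMomentum L M), F' ω' k ≠ 0 → ∑ ω, F ω k = 1) (G : HubbardGrassmann L M)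
    {cr cc : ℝ} (hcr0 : 0 ≤ cr) (hcc0 : 0 ≤ cc)
    (hrow' : ∀ X'', ∑ X', ‖(sectorAnalysisMatrix L M β F' * sectorSubMatrix L M β Ft) X'' X'‖ ≤ cr)
    (hcol' : ∀ X', ∑ X'', ‖(sectorAnalysisMatrix L M β F' * sectorSubMatrix L M β Ft) X'' X'‖ ≤ cc)
    (m : ℕ) (A : Finset (Fin (m + 1) → SectorLeg N')) :
    hubbardSectorKernelNorm L M β F' A G ≤
      cr * cc ^ m * imagTimeWeight β M ^ m *
        (imagTimeWeight β M * hubbardSectorKernelNorm L M β F (univ : Finset (Fin (m + 1) → SectorLeg N)) G) := by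
  have hε : 0 ≤ imagTimeWeight β M := imagTimeWeight_nonneg hβ.le M
  -- the `F′`-norm is read off the analysis map, which factors through the preimage
  refine (hubbardSectorKernelNorm_le_kernelNorm_map hβ.le F' A G).trans ?_
  rw [map_sectorAnalysis_eq_map_comp_sectorPreimage_of_plateau hβ.ne' F Ft hFF hF0 F' hF'pl G]
  -- Young: one overlap norm per leg
  have hY := kernelNorm_kernel_map_le
    (Matrix.toLin' (sectorAnalysisMatrix L M β F') ∘ₗ Matrix.toLin' (sectorSubMatrix L M β Ft)) hcr0 hcc0
    (by intro X''; rw [LinearMap.toMatrix'_comp, LinearMap.toMatrix'_toLin', LinearMap.toMatrix'_toLin']; exact hrow' X'')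
    (by intro X'; simp only [LinearMap.toMatrix'_comp, LinearMap.toMatrix'_toLin']; exact hcol' X') hε (sectorPreimage β F G) m
  refine hY.trans ?_
  -- the preimage's kernels in the sectorised currency
  rw [kernelNorm_eq_pow_mul_kernelNorm_one hε, mul_assoc (cr * cc ^ m)]
  exact mul_le_mul_of_nonneg_left (mul_le_mul_of_nonneg_left (kernelNorm_kernel_sectorPreimage_le hβ.le F G m) (pow_nonneg hε m))
    (mul_nonneg hcr0 (pow_nonneg hcc0 m))

/-! ### The decay-weighted twin: weighted pinned sums across a plateau pair -/

section Weighted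

open Literature.Probability.LatticeModels.BattleFederbush

variable {Λ : Type*} [DecidableEq Λ] {wt : Finset Λ → ℝ}

/-- **Weighted re-sectorisation across a plateau pair** (BGM 2006, (2.71a)/(2.82) with the decay bookkeeping of §3: one WEIGHTED overlap norm
per external leg, no integration): for a tree weight `wt` on the position sets, position maps `π` (labels of `F`) and `π″` (labels of `F′`), a
thin/fat pair `F, F̃` and a family `F′` supported in the plateau of `F`, weighted overlap constants
`Σ_{X′} ‖(E(F′)·S(F̃))(X″,X′)‖·wt{π″ X″, π X′} ≤ cr`, `Σ_{X″} … ≤ cc`, and weighted input sizes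
`Σ_{Y_q = w} wt(π Y) ‖kernel (map (toLin' E(F)) G) (m+1) Y‖ ≤ B` (every pinned leg `q`): in degree `m + 1`, one output leg pinned,
`Σ_{X″_p = w″} wt(π″ X″) ‖kernel (map (toLin' E(F′)) G) (m+1) X″‖ ≤ cr · cc^m · (ε_x^{m+1} · B)`. [cite: BenfattoGiulianiMastropietro2006, §2.8 (2.82)] -/
theorem sum_wt_norm_sectorAnalysis_le_of_plateau_pair (hwt : IsTreeWeight wt)
    (π : SpaceTimeIdx L M × SectorLeg N → Λ) (π'' : SpaceTimeIdx L M × SectorLeg N' → Λ)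
    {β : ℝ} (hβ : 0 < β) (F Ft : Fin N → FreqMomentum L M → ℂ)
    (hFF : ∀ ω k, Ft ω k * F ω k = F ω k) (hF0 : ∀ k, ∑ ω, F ω k = 0 → ∀ ω, F ω k = 0) (F' : Fin N' → FreqMomentum L M → ℂ)
    (hF'pl : ∀ (ω' : Fin N') (k : FreqMomentum L M), F' ω' k ≠ 0 → ∑ ω, F ω k = 1) (G : HubbardGrassmann L M)
    {cr cc : ℝ} (hcc0 : 0 ≤ cc)
    (hrow' : ∀ X'', ∑ X', ‖(sectorAnalysisMatrix L M β F' * sectorSubMatrix L M β Ft) X'' X'‖ * wt {π'' X'', π X'} ≤ cr)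
    (hcol' : ∀ X', ∑ X'', ‖(sectorAnalysisMatrix L M β F' * sectorSubMatrix L M β Ft) X'' X'‖ * wt {π'' X'', π X'} ≤ cc)
    {m : ℕ} {B : ℝ} (hB0 : 0 ≤ B)
    (hB : ∀ (q : Fin (m + 1)) (w : SpaceTimeIdx L M × SectorLeg N),
      ∑ Y ∈ univ.filter (fun Y : Fin (m + 1) → SpaceTimeIdx L M × SectorLeg N => Y q = w),
        wt ((univ.image Y).image π) * ‖kernel ℂ (ExteriorAlgebra.map (Matrix.toLin' (sectorAnalysisMatrix L M β F)) G) (m + 1) Y‖ ≤ B)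
    (p : Fin (m + 1)) (w'' : SpaceTimeIdx L M × SectorLeg N') :
    ∑ X'' ∈ univ.filter (fun X'' : Fin (m + 1) → SpaceTimeIdx L M × SectorLeg N' => X'' p = w''),
        wt ((univ.image X'').image π'') * ‖kernel ℂ (ExteriorAlgebra.map (Matrix.toLin' (sectorAnalysisMatrix L M β F')) G) (m + 1) X''‖ ≤
      cr * cc ^ m * (imagTimeWeight β M ^ (m + 1) * B) := by
  have hε : 0 ≤ imagTimeWeight β M := imagTimeWeight_nonneg hβ.le M
  -- the `F′`-analysis factors through the preimage
  rw [map_sectorAnalysis_eq_map_comp_sectorPreimage_of_plateau hβ.ne' F Ft hFF hF0 F' hF'pl G]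
  -- the weighted pinned sums of the preimage's kernels
  have hwl : ∀ S : Finset (SpaceTimeIdx L M × SectorLeg N), 0 ≤ wt (S.image π) := fun S => zero_le_one.trans (hwt.one_le _)
  have hN := sum_wt_norm_kernel_sectorPreimage_le hβ.le F G (fun S => wt (S.image π)) hwl hB0 hB
  -- weighted Young: one overlap norm per leg
  exact sum_filter_wt_norm_kernel_map_le hwt π π''
    (Matrix.toLin' (sectorAnalysisMatrix L M β F') ∘ₗ Matrix.toLin' (sectorSubMatrix L M β Ft)) hcc0
    (by intro X''; rw [LinearMap.toMatrix'_comp, LinearMap.toMatrix'_toLin', LinearMap.toMatrix'_toLin']; exact hrow' X'')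
    (by intro X'; simp only [LinearMap.toMatrix'_comp, LinearMap.toMatrix'_toLin']; exact hcol' X') (sectorPreimage β F G) m
    (mul_nonneg (pow_nonneg hε _) hB0) hN p w''

end Weighted

end Literature.MathematicalPhysics.QuantumLattice

end
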